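import Summits.BirchSwinnertonDyer.BirchSwinnertonDyer.Theorems.SignedLowerHalvesSmallImageLowerHalfBothSignsRttD2SeqSemilocData
import Summits.BirchSwinnertonDyer.BirchSwinnertonDyer.Theorems.SignedLowerHalvesSmallImageLowerHalfBothSignsRttD2J1CyclotomicCarrier
import Mathlib.Data.Fintype.Card
import HarnessLib

/-!
# Route `SignedLowerHalves`, crux L `SmallImageLowerHalfBothSigns` (stmt-BirchSwinnertonDyer-23599), line `rtt_w3` v29 — row S3α (`stub_junctionSha_ns`), brick α2 (abstract half), LEAD g14:
# A PINNED IWASAWA DATUM WHOSE LEVEL GROUPS ARE UNIFORMLY BOUNDED IS FINITE (of cardinality at most the bound)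

WHY (HELPER-TABLE addendum 28 = S3α brick table rev 3; LEAD `cruxlead-stmt-BirchSwinnertonDyer-23599` g14). With the hypothesis-free socket
`lambdaInvariant_le_of_sha_range(_of_finite)` (p812938) the only finiteness S3α needs is that of the local target
`Loc = Π_{w ∈ P} 𝐇²_{Iw,w}` of the degree-2 semilocal map, i.e. `Finite (L₂ w).H` for -w3's pinned semilocal data
`L₂ w : SemilocIwasawaCohomologyDataO S κ γ θ′ P w 2` at the finitely many `w ∈ P`. That finiteness splits into (lev) a UNIFORM bound on the level groups
`H²(Γ_{K_w}, Maps(Γ_K ⧸ U_n, X_k))` (local duality in bidegree `(2,0)` + Mackey; (R) of `CharRoadFrameSupp` at `w ≠ vp`, the height-two character at `vp`) and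
(lim) the passage from the levels to the pinned limit datum. THIS FILE is (lim), pure combinatorics of jointly-injective compatible projections:

* ★ `finite_and_natCard_le_of_bounded_levels` — GENERIC: a type `H` with maps `proj n k : H → Lv n k` compatible with transitions `Lv (n+1) k → Lv n k`, `Lv n (k+1) → Lv n k`
  and jointly injective, all `Lv n k` finite of cardinality `≤ B` ⟹ `H` is finite and `Nat.card H ≤ B` (two points separated at one level stay separated at every later
  level; a finite set of points is separated at one common level);
* `SemilocIwasawaCohomologyDataO.finite_and_natCard_le_of_levels` — for -w3's semilocal data (every degree `i`, every place `w`);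
* `CycIwasawaCohomologyDataO.finite_and_natCard_le_of_levels` — the same for honda's cyclotomic data (every degree);
* `finite_pi_semiloc_of_levels` — `Finite (Π_{w ∈ P} (L w).H)` for finite `P` under levelwise uniform bounds.

THEOREMS ONLY (`--supports stmt-BirchSwinnertonDyer-23599` helper); closes nothing; crux L, crux M, S3α and BSD remain OPEN and are proved for NO curve by any of this.
[cite: NeukirchSchmidtWingberg2008, (8.6.2)–(8.6.3)] [cite: Washington1997, §13.2] [folklore]
-/

set_option autoImplicit false
-- the Theorems namespace of this sub repeats the summit name by design (D-0017 nested layout)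
set_option linter.dupNamespace false

noncomputable section

namespace Summit.BirchSwinnertonDyer.BirchSwinnertonDyer.Theorems.SmallImageRttD2Seq

universe u₁ u₂

/-! ## §1 Generic: jointly injective compatible projections onto uniformly bounded finite levels -/

section Generic

variable {H : Type u₁} {Lv : ℕ → ℕ → Type u₂}
  (proj : ∀ n k : ℕ, H → Lv n k) (c : ∀ n k : ℕ, Lv (n + 1) k → Lv n k) (r : ∀ n k : ℕ, Lv n (k + 1) → Lv n k)

/-- Separation propagates up the first index: if `proj n k` separates `x, y` then so does `proj m k` for every `m ≥ n`. [folklore] -/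
theorem proj_ne_of_proj_ne_left (hc : ∀ n k x, c n k (proj (n + 1) k x) = proj n k x)
    {x y : H} {n k : ℕ} (h : proj n k x ≠ proj n k y) {m : ℕ} (hm : n ≤ m) : proj m k x ≠ proj m k y := by
  induction m, hm using Nat.le_induction with
  | base => exact h
  | succ m hm ih =>
    intro habs
    apply ih
    rw [← hc m k x, ← hc m k y, habs]

/-- Separation propagates up the second index: if `proj n k` separates `x, y` then so does `proj n m` for every `m ≥ k`. [folklore] -/
theorem proj_ne_of_proj_ne_right (hr : ∀ n k x, r n k (proj n (k + 1) x) = proj n k x)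
    {x y : H} {n k : ℕ} (h : proj n k x ≠ proj n k y) {m : ℕ} (hm : k ≤ m) : proj n m x ≠ proj n m y := by
  induction m, hm using Nat.le_induction with
  | base => exact h
  | succ m hm ih =>
    intro habs
    apply ih
    rw [← hr n m x, ← hr n m y, habs]

/-- Separation is monotone in the level: separated at `(n, k)` ⟹ separated at every `(n′, k′) ≥ (n, k)`. [folklore] -/
theorem proj_ne_of_proj_ne_of_le (hc : ∀ n k x, c n k (proj (n + 1) k x) = proj n k x)
    (hr : ∀ n k x, r n k (proj n (k + 1) x) = proj n k x)
    {x y : H} {n k n' k' : ℕ} (hn : n ≤ n') (hk : k ≤ k') (h : proj n k x ≠ proj n k y) :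
    proj n' k' x ≠ proj n' k' y :=
  proj_ne_of_proj_ne_right proj r hr (proj_ne_of_proj_ne_left proj c hc h hn) hk

/-- ★ **Uniformly bounded finite levels ⟹ finite limit.** If the projections `proj n k : H → Lv n k` are compatible with the transitions `c`, `r`, jointly
injective, and every level is finite with `Nat.card (Lv n k) ≤ B`, then `H` is finite and `Nat.card H ≤ B`. (Any finite set of elements of `H` is separated
at one common level, so it has at most `B` elements.) [cite: NeukirchSchmidtWingberg2008, (8.6.2)–(8.6.3)] [folklore] -/
theorem finite_and_natCard_le_of_bounded_levels (hc : ∀ n k x, c n k (proj (n + 1) k x) = proj n k x)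
    (hr : ∀ n k x, r n k (proj n (k + 1) x) = proj n k x)
    (hinj : ∀ x y : H, (∀ n k, proj n k x = proj n k y) → x = y)
    (hfin : ∀ n k, Finite (Lv n k)) {B : ℕ} (hB : ∀ n k, Nat.card (Lv n k) ≤ B) :
    Finite H ∧ Nat.card H ≤ B := by
  classical
  -- two distinct points are separated at some level
  have sep : ∀ x y : H, x ≠ y → ∃ nk : ℕ × ℕ, proj nk.1 nk.2 x ≠ proj nk.1 nk.2 y := by
    intro x y hxy
    by_contra hcon
    exact hxy (hinj x y fun n k ↦ by
      by_contra h'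
      exact hcon ⟨(n, k), h'⟩)
  -- a separating level for each ordered pair (junk `(0,0)` on the diagonal)
  let lvl : H → H → ℕ × ℕ := fun x y ↦ if hxy : x ≠ y then Classical.choose (sep x y hxy) else (0, 0)
  have hlvl : ∀ x y : H, x ≠ y → proj (lvl x y).1 (lvl x y).2 x ≠ proj (lvl x y).1 (lvl x y).2 y := by
    intro x y hxy
    have hl : lvl x y = Classical.choose (sep x y hxy) := dif_pos hxy
    rw [hl]
    exact Classical.choose_spec (sep x y hxy)
  -- every finset of `H` has at most `B` elements
  have key : ∀ s : Finset H, s.card ≤ B := by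
    intro s
    let N : ℕ := s.sup fun x ↦ s.sup fun y ↦ (lvl x y).1
    let K : ℕ := s.sup fun x ↦ s.sup fun y ↦ (lvl x y).2
    have hN : ∀ x ∈ s, ∀ y ∈ s, (lvl x y).1 ≤ N := fun x hx y hy ↦
      (Finset.le_sup (f := fun y ↦ (lvl x y).1) hy).trans (Finset.le_sup (f := fun x ↦ s.sup fun y ↦ (lvl x y).1) hx)
    have hK : ∀ x ∈ s, ∀ y ∈ s, (lvl x y).2 ≤ K := fun x hx y hy ↦
      (Finset.le_sup (f := fun y ↦ (lvl x y).2) hy).trans (Finset.le_sup (f := fun x ↦ s.sup fun y ↦ (lvl x y).2) hx)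
    have hinjOn : Set.InjOn (proj N K) s := by
      intro x hx y hy hxy
      by_contra hne
      exact proj_ne_of_proj_ne_of_le proj c r hc hr (hN x hx y hy) (hK x hx y hy) (hlvl x y hne) hxy
    haveI := hfin N K
    haveI : Fintype (Lv N K) := Fintype.ofFinite _
    calc s.card = (s.image (proj N K)).card := (Finset.card_image_of_injOn hinjOn).symm
      _ ≤ Fintype.card (Lv N K) := Finset.card_le_univ _
      _ = Nat.card (Lv N K) := (Nat.card_eq_fintype_card).symm
      _ ≤ B := hB N K
  have hfinite : Finite H := by
    by_contra hinf
    haveI : Infinite H := not_finite_iff_infinite.mp hinf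
    obtain ⟨s, hs⟩ := Infinite.exists_subset_card_eq H (B + 1)
    have := key s
    omega
  refine ⟨hfinite, ?_⟩
  haveI : Fintype H := Fintype.ofFinite H
  rw [Nat.card_eq_fintype_card]
  exact key Finset.univ

end Generic

/-! ## §2 -w3's semilocal data and honda's cyclotomic data -/

section Data

open scoped NumberField
open IsDedekindDomain Field
open Literature.NumberTheory.EllipticCurves Literature.NumberTheory.GaloisRepresentations

variable {K : Type} [Field K] [NumberField K] {p : ℕ} [Fact p.Prime] {S : Set (PadicAlgCl p)} {κ : ZpExtension K p} {γ : absoluteGaloisGroup K}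
  {θ' : absoluteGaloisGroup K →ₜ* (padicCoeffIntegers S)ˣ} {P : Set (HeightOneSpectrum (𝓞 K))} {w : HeightOneSpectrum (𝓞 K)} {i : ℕ}

/-- ★ **Semilocal Iwasawa cohomology with uniformly bounded levels is finite**: for -w3's pinned datum `L : SemilocIwasawaCohomologyDataO S κ γ θ′ P w i`, if every level
`semilocCoh S κ θ′ P w n k i = H^i(Γ_{K_w}, Maps(Γ_K ⧸ U_n, X_k))` is finite of cardinality `≤ B`, then `L.H` is finite with `Nat.card L.H ≤ B` ((P1)–(P3)).
Consumer: S3α brick α2 (`Finite Loc`). [cite: NeukirchSchmidtWingberg2008, (8.6.2)–(8.6.3)] [cite: Kato2004Asterisque, §8.2 (p. 180)] -/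
theorem SemilocIwasawaCohomologyDataO.finite_and_natCard_le_of_levels (L : SemilocIwasawaCohomologyDataO S κ γ θ' P w i)
    (hfin : ∀ n k, Finite (semilocCoh S κ θ' P w n k i)) {B : ℕ} (hB : ∀ n k, Nat.card (semilocCoh S κ θ' P w n k i) ≤ B) :
    Finite L.H ∧ Nat.card L.H ≤ B :=
  finite_and_natCard_le_of_bounded_levels (fun n k x ↦ L.proj n k x) (fun n k ↦ semilocCores S κ θ' P w n k i) (fun n k ↦ semilocRed S κ θ' P w n k i)
    L.proj_cores L.proj_red (fun _ _ h ↦ L.eq_of_forall_proj_eq h) hfin hB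

/-- The same for honda's cyclotomic datum `I : CycIwasawaCohomologyDataO S κ γ θ′ P i` (any degree): uniformly bounded finite levels ⟹ `I.H` finite, `Nat.card I.H ≤ B`.
[cite: NeukirchSchmidtWingberg2008, (8.6.2)–(8.6.3)] [cite: JohnsonLeungKings2011, §4.2 Def. 4.2] -/
theorem _root_.Summit.BirchSwinnertonDyer.BirchSwinnertonDyer.Theorems.SmallImageRttD2J1.CycIwasawaCohomologyDataO.finite_and_natCard_le_of_levels
    (I : SmallImageRttD2J1.CycIwasawaCohomologyDataO S κ γ θ' P i)
    (hfin : ∀ n k, Finite (SmallImageRttD2J1.cycLayerCohO S κ θ' P n k i)) {B : ℕ}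
    (hB : ∀ n k, Nat.card (SmallImageRttD2J1.cycLayerCohO S κ θ' P n k i) ≤ B) :
    Finite I.H ∧ Nat.card I.H ≤ B :=
  finite_and_natCard_le_of_bounded_levels (fun n k x ↦ I.proj n k x) (fun n k ↦ SmallImageRttD2J1.cycLayerCoresO S κ θ' P n k i)
    (fun n k ↦ SmallImageRttD2J1.cycLayerRedO S κ θ' P n k i) I.proj_cores I.proj_red
    (fun x y h ↦ by
      rw [← sub_eq_zero]
      exact I.proj_injective _ fun n k ↦ by rw [map_sub, h n k, sub_self]) hfin hB

/-- **`Finite Loc`**: for a finite set of places `P` and pinned semilocal data `L w` (`w ∈ P`, degree `i`) with uniformly bounded finite levels at each `w`, the product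
`Π_{w ∈ P} (L w).H` is finite — the hypothesis `[Finite Loc]` of `lambdaInvariant_le_of_sha_range_of_finite` (p812938) for S3α. [folklore] -/
theorem finite_pi_semiloc_of_levels (hP : P.Finite) (L : ∀ w : P, SemilocIwasawaCohomologyDataO S κ γ θ' P (w : HeightOneSpectrum (𝓞 K)) i)
    (hfin : ∀ (w : P) (n k : ℕ), Finite (semilocCoh S κ θ' P (w : HeightOneSpectrum (𝓞 K)) n k i))
    (hB : ∀ w : P, ∃ B : ℕ, ∀ n k, Nat.card (semilocCoh S κ θ' P (w : HeightOneSpectrum (𝓞 K)) n k i) ≤ B) :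
    Finite (∀ w : P, (L w).H) := by
  haveI : Finite P := hP.to_subtype
  haveI : ∀ w : P, Finite (L w).H := fun w ↦ by
    obtain ⟨B, hBw⟩ := hB w
    exact ((L w).finite_and_natCard_le_of_levels (hfin w) hBw).1
  infer_instance

end Data

end Summit.BirchSwinnertonDyer.BirchSwinnertonDyer.Theorems.SmallImageRttD2Seq
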